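import Mathlib
import HarnessLib
import Summits.AtomisticToContinuum.Crystallization.Theses.BraggSlacknessRigidity
import Literature.MathematicalPhysics.StatisticalMechanics.LennardJonesClusters

/-!
# Route BraggSlacknessRigidity — the Assembly item (stmt-AtomisticToContinuum-13172)

`Assembly := StrictCertificate → HcpDiffractionRigidity → StrictImpliesExact → CertificateBound →
EnergeticHalf → TrialStateUpper → SlacknessTransfer → Crystallization` is the Prop form of the
route's deciding theorem `closes`; its proof is that theorem's body: pure logic over the seven
antecedents plus the PROVED Literature theorem `LennardJonesMinimalDistance_holds` (Lennard-Jones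
ground states have a uniform hard core).
-/

namespace Summit.AtomisticToContinuum.Crystallization.Theorems

open Summit.AtomisticToContinuum.Crystallization.Theses.BraggSlacknessRigidity
open Literature.MathematicalPhysics.StatisticalMechanics

/-- **Assembly of route BraggSlacknessRigidity** (item stmt-AtomisticToContinuum-13172).
Energetic conjunct (i): `StrictImpliesExact` turns the strict hcp certificate into an exact
three-cone certificate, `CertificateBound` turns that into the Kepler bound, and `EnergeticHalf`
combines the Kepler bound with `TrialStateUpper` into
`HasPeriodicGroundStateEnergy lennardJones 3`.
Positional conjunct (ii): `SlacknessTransfer` fed with the strict certificate, `TrialStateUpper`,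
the proved hard-core theorem `LennardJonesMinimalDistance_holds` and the diffraction-rigidity
engine `HcpDiffractionRigidity` gives `IsCrystallizing lennardJones 3`.
The pair is `Crystallization`. -/
theorem braggSlacknessRigidity_assembly_proof :
    Summit.AtomisticToContinuum.Crystallization.Theses.BraggSlacknessRigidity.Assembly := by
  unfold Summit.AtomisticToContinuum.Crystallization.Theses.BraggSlacknessRigidity.Assembly
  intro h_Strict h_Rigidity h_StrictImpliesExact h_CertificateBound h_EnergeticHalf
    h_TrialStateUpper h_SlacknessTransfer
  -- (i) energetic conjunct: strict ⇒ exact certificate ⇒ Kepler bound ⇒ (with the trial-state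
  -- upper bound) a periodic ground-state energy
  have h_exact : ExactCertificate := h_StrictImpliesExact h_Strict
  have h_kepler : KeplerBound := h_CertificateBound h_exact
  have h_energy : HasPeriodicGroundStateEnergy lennardJones 3 :=
    h_EnergeticHalf h_kepler h_TrialStateUpper
  -- (ii) positional conjunct: two-sided complementary slackness + hard core + diffraction rigidity
  have h_pos : IsCrystallizing lennardJones 3 :=
    h_SlacknessTransfer h_Strict h_TrialStateUpper LennardJonesMinimalDistance_holds h_Rigidity
  exact ⟨h_energy, h_pos⟩

end Summit.AtomisticToContinuum.Crystallization.Theorems
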